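import Literature.Probability.RandomPlanarGeometry.SAWWordBridges
import Literature.Probability.RandomPlanarGeometry.SAWUnfoldingStep
import Mathlib.Algebra.Order.BigOperators.Ring.Finset
import Mathlib.Algebra.BigOperators.Intervals
import HarnessLib

/-!
# Line `kesten-product-renewal-dictionary` for the crux `SAWTotalPositivity.CriticalBubbleBound`
(stmt-CriticalPhenomena-7117): the Hammersley–Welsh product bound in generating-function form

Source: N. Madras, G. Slade, *The Self-Avoiding Walk* (1993), §3.1, eq. (3.1.2)–(3.1.4) (proof of
Theorem 3.1.3 via Proposition 3.1.5): a half-space self-avoiding walk decomposes, by cutting at the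
last time its first coordinate is maximal, into a bridge of span `A₁` followed by a half-space walk
of strictly smaller maximal level; iterating, half-space walks are encoded injectively by finite
sequences of bridges of strictly decreasing spans, whence `H(x) ≤ ∏_{a ≥ 1} (1 + B_a(x))`.

We work in the step-word model of `SAWWords.lean` / `SAWWordBridges.lean` (`Step = Fin 4`, `traj`,
`xEnd`, `IsBridgeW`) with `Zd.IsHalfSpace`, `Zd.maxLevel` of `SAWBridges.lean` /
`SAWUnfoldingStep.lean`, and with length truncations (`|w| ≤ N`), so that all the generating
functions are finite sums. Writing

* `M_N(h) = ∑ x^{|w|}` over self-avoiding half-space words of length `≤ N` and maximal level `≤ h`,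
* `B_N(a) = ∑ x^{|w|}` over self-avoiding bridge words of length `≤ N` and span `a`,

the main result `hw_product_bound` is: **given** the one-step cut (an injective map sending a
non-empty self-avoiding half-space word of maximal level `A` to a self-avoiding bridge word of span
`A` and a self-avoiding half-space word of maximal level `≤ A - 1`, the lengths adding up — proved
elsewhere in the line and taken here as a HYPOTHESIS), for every real `x ≥ 0` and all `N, h`,

`M_N(h) ≤ ∏_{a=1}^{h} (1 + B_N(a))`.

Proof. Slicing the non-empty words by their maximal level `a ∈ [1, h]` and applying the cut on
each fibre gives the renewal inequality `M_N(h) ≤ 1 + ∑_{a=1}^{h} B_N(a) M_N(a-1)`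
(`halfSpaceMass_le_one_add_sum_fibre`, `fibre_mass_le`); the partial products
`Q(h) = ∏_{a=1}^{h} (1 + B_N(a))` satisfy the matching identity `Q(h) = 1 + ∑_{a=1}^{h} B_N(a) Q(a-1)`
(`prod_one_add_eq_one_add_sum`), and strong induction on `h` concludes (`le_prod_of_renewal`).
-/

noncomputable section

open Literature.Probability.LatticeModels
open Literature.Probability.RandomPlanarGeometry Literature.Probability.RandomPlanarGeometry.SAW
open scoped ENNReal NNReal BigOperators
open Classical

namespace Summit.CriticalPhenomena.SAWScalingLimit.Theorems.CriticalBubbleBound.Kesten.HW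

/-! ## Real-number bookkeeping: the renewal induction -/

/-- The partial products `Q(k) = ∏_{a=1}^{k} (1 + B_a)` solve the renewal identity
`Q(k) = 1 + ∑_{a=1}^{k} B_a Q(a-1)` (telescoping: `Q(k+1) - Q(k) = B_{k+1} Q(k)`). [folklore] -/
theorem prod_one_add_eq_one_add_sum (B : ℕ → ℝ) (k : ℕ) :
    ∏ a ∈ Finset.Icc 1 k, (1 + B a) =
      1 + ∑ a ∈ Finset.Icc 1 k, B a * ∏ b ∈ Finset.Icc 1 (a - 1), (1 + B b) := by
  induction k with
  | zero =>
    rw [Finset.Icc_eq_empty_of_lt Nat.zero_lt_one]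
    simp
  | succ k ih =>
    rw [Finset.prod_Icc_succ_top (Nat.le_add_left 1 k),
      Finset.sum_Icc_succ_top (Nat.le_add_left 1 k), Nat.add_sub_cancel, ih]
    ring

/-- **Renewal induction.** If `M(h) ≤ 1 + ∑_{a=1}^{h} B_a M(a-1)` for all `h`, with `B_a ≥ 0`, then
`M(h) ≤ ∏_{a=1}^{h} (1 + B_a)`: strong induction on `h`, comparing with the identity
`prod_one_add_eq_one_add_sum` for the partial products.
[cite: MadrasSlade1993, §3.1, eq. (3.1.2)–(3.1.4)] -/
theorem le_prod_of_renewal {M B : ℕ → ℝ} (hB : ∀ a, 0 ≤ B a)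
    (hM : ∀ h, M h ≤ 1 + ∑ a ∈ Finset.Icc 1 h, B a * M (a - 1)) (h : ℕ) :
    M h ≤ ∏ a ∈ Finset.Icc 1 h, (1 + B a) := by
  induction h using Nat.strong_induction_on with
  | _ h ih =>
    rw [prod_one_add_eq_one_add_sum]
    refine (hM h).trans (add_le_add le_rfl (Finset.sum_le_sum fun a ha => ?_))
    exact mul_le_mul_of_nonneg_left
      (ih (a - 1) (by have := Finset.mem_Icc.1 ha; omega)) (hB a)

/-- Transport of a sum along an injection into a larger index set carrying non-negative weights:
if `e` is injective, maps `s` into `t`, and `f i = g (e i)` on `s` with `g ≥ 0` on `t`, then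
`∑_{i ∈ s} f i ≤ ∑_{j ∈ t} g j`. [folklore] -/
theorem sum_le_sum_of_injective {ι κ : Type*} {s : Finset ι} {t : Finset κ} (e : ι → κ)
    (he : Function.Injective e) (hst : ∀ i ∈ s, e i ∈ t) {f : ι → ℝ} {g : κ → ℝ}
    (hg : ∀ j ∈ t, 0 ≤ g j) (hfg : ∀ i ∈ s, f i = g (e i)) :
    ∑ i ∈ s, f i ≤ ∑ j ∈ t, g j := by
  calc ∑ i ∈ s, f i = ∑ i ∈ s, g (e i) := Finset.sum_congr rfl hfg
    _ = ∑ j ∈ s.image e, g j := (Finset.sum_image he.injOn).symm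
    _ ≤ ∑ j ∈ t, g j :=
        Finset.sum_le_sum_of_subset_of_nonneg (Finset.image_subset_iff.2 hst)
          fun j hj _ => hg j hj

/-! ## The word sets -/

/-- Membership in the finite set of self-avoiding words of length `≤ N` with a property `P`
(the common shape of the half-space and bridge word sets of the product bound). [folklore] -/
theorem mem_biUnion_sawWords_filter {N : ℕ} {P : List Step → Prop} [DecidablePred P]
    {w : List Step} :
    w ∈ (Finset.range (N + 1)).biUnion (fun n => (sawWords n).filter P) ↔
      w.length ≤ N ∧ IsSAW w ∧ P w := by
  simp only [Finset.mem_biUnion, Finset.mem_range, Finset.mem_filter, mem_sawWords]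
  constructor
  · rintro ⟨n, hn, ⟨hl, hs⟩, hp⟩
    exact ⟨by omega, hs, hp⟩
  · rintro ⟨hl, hs, hp⟩
    exact ⟨w.length, by omega, ⟨rfl, hs⟩, hp⟩

/-- A non-empty half-space word is at level `≥ 1` after its first step, so its maximal first
coordinate `A₁` is at least `1`. [cite: MadrasSlade1993, Definition 3.1.2] -/
theorem one_le_maxLevel_of_ne_nil {w : List Step} (hH : Zd.IsHalfSpace w.length (traj w))
    (hne : w ≠ []) : 1 ≤ Zd.maxLevel w.length (traj w) := by
  have h1 : 1 ≤ w.length := List.length_pos_iff.2 hne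
  have hlt := hH 1 le_rfl h1
  simp only [traj_zero, Pi.zero_apply] at hlt
  have hmax := Zd.apply_le_maxLevel (traj w) h1
  omega

/-! ## The fibre bound and the slicing by the maximal level -/

/-- **Fibre bound.** On the half-space words (length `≤ N`, maximal level `≤ h`) that are non-empty
with maximal level (as a natural number) exactly `a`, the one-step cut `cut` is injective with
values in (bridge words of span `a`, length `≤ N`) × (half-space words of maximal level `≤ a - 1`,
length `≤ N`), and `x^{|w|} = x^{|u|} x^{|v|}` for `cut w = (u, v)`; hence the `x`-mass of this
fibre is at most `B_N(a) · M_N(a-1)` (for `a = 0` the fibre is empty: a non-empty half-space word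
has maximal level `≥ 1`). [cite: MadrasSlade1993, §3.1, eq. (3.1.2)–(3.1.4)] -/
theorem fibre_mass_le {cut : List Step → List Step × List Step} (hinj : Function.Injective cut)
    (hcut : ∀ w : List Step, IsSAW w → Zd.IsHalfSpace w.length (traj w) → w ≠ [] →
      IsSAW (cut w).1 ∧ IsBridgeW (cut w).1 ∧ xEnd (cut w).1 = Zd.maxLevel w.length (traj w) ∧
      IsSAW (cut w).2 ∧ Zd.IsHalfSpace (cut w).2.length (traj (cut w).2) ∧
      Zd.maxLevel (cut w).2.length (traj (cut w).2) + 1 ≤ Zd.maxLevel w.length (traj w) ∧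
      (cut w).1.length + (cut w).2.length = w.length)
    {x : ℝ} (hx : 0 ≤ x) (N h a : ℕ) :
    ∑ w ∈ (((Finset.range (N + 1)).biUnion (fun n => (sawWords n).filter
        (fun w => Zd.IsHalfSpace w.length (traj w) ∧
          Zd.maxLevel w.length (traj w) ≤ (h : ℤ)))).filter (fun w => ¬ w = [])).filter
        (fun w => (Zd.maxLevel w.length (traj w)).toNat = a), x ^ w.length ≤
      (∑ w ∈ (Finset.range (N + 1)).biUnion (fun n => (sawWords n).filter
          (fun w => IsBridgeW w ∧ xEnd w = (a : ℤ))), x ^ w.length) *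
        ∑ w ∈ (Finset.range (N + 1)).biUnion (fun n => (sawWords n).filter
          (fun w => Zd.IsHalfSpace w.length (traj w) ∧
            Zd.maxLevel w.length (traj w) ≤ ((a - 1 : ℕ) : ℤ))), x ^ w.length := by
  rw [Finset.sum_mul_sum, ← Finset.sum_product']
  refine sum_le_sum_of_injective cut hinj (fun w hw => ?_)
    (fun p _ => mul_nonneg (pow_nonneg hx _) (pow_nonneg hx _)) (fun w hw => ?_)
  · -- `cut w` lies in the product set
    simp only [Finset.mem_filter] at hw
    obtain ⟨⟨hw, hne⟩, hwa⟩ := hw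
    obtain ⟨hl, hs, hH, -⟩ := mem_biUnion_sawWords_filter.1 hw
    obtain ⟨hs1, hb1, hx1, hs2, hH2, hm2, hlen⟩ := hcut w hs hH hne
    have h1 := one_le_maxLevel_of_ne_nil hH hne
    have hma : Zd.maxLevel w.length (traj w) = (a : ℤ) := by omega
    rw [Finset.mem_product]
    exact ⟨mem_biUnion_sawWords_filter.2 ⟨by omega, hs1, hb1, hx1.trans hma⟩,
      mem_biUnion_sawWords_filter.2 ⟨by omega, hs2, hH2, by omega⟩⟩
  · -- the weight factors along the cut
    simp only [Finset.mem_filter] at hw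
    obtain ⟨⟨hw, hne⟩, -⟩ := hw
    obtain ⟨-, hs, hH, -⟩ := mem_biUnion_sawWords_filter.1 hw
    rw [← pow_add, (hcut w hs hH hne).2.2.2.2.2.2]

/-- **Slicing by the maximal level.** The `x`-mass (`x ≥ 0`) of the self-avoiding half-space words
of length `≤ N` and maximal level `≤ h` is at most `1` (the empty word) plus the sum over
`a = 1, …, h` of the masses of the fibres of non-empty words of maximal level exactly `a` (a
non-empty half-space word has maximal level in `[1, h]`). [cite: MadrasSlade1993, §3.1] -/
theorem halfSpaceMass_le_one_add_sum_fibre {x : ℝ} (hx : 0 ≤ x) (N h : ℕ) :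
    ∑ w ∈ (Finset.range (N + 1)).biUnion (fun n => (sawWords n).filter
        (fun w => Zd.IsHalfSpace w.length (traj w) ∧ Zd.maxLevel w.length (traj w) ≤ (h : ℤ))),
        x ^ w.length ≤
      1 + ∑ a ∈ Finset.Icc 1 h,
        ∑ w ∈ (((Finset.range (N + 1)).biUnion (fun n => (sawWords n).filter
          (fun w => Zd.IsHalfSpace w.length (traj w) ∧
            Zd.maxLevel w.length (traj w) ≤ (h : ℤ)))).filter (fun w => ¬ w = [])).filter
          (fun w => (Zd.maxLevel w.length (traj w)).toNat = a), x ^ w.length := by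
  rw [← Finset.sum_filter_add_sum_filter_not _ (fun w : List Step => w = []),
    Finset.sum_fiberwise_of_maps_to (t := Finset.Icc 1 h)
      (g := fun w : List Step => (Zd.maxLevel w.length (traj w)).toNat)]
  · refine add_le_add ?_ le_rfl
    calc ∑ w ∈ ((Finset.range (N + 1)).biUnion (fun n => (sawWords n).filter
          (fun w => Zd.IsHalfSpace w.length (traj w) ∧
            Zd.maxLevel w.length (traj w) ≤ (h : ℤ)))).filter (fun w => w = []), x ^ w.length
        ≤ ∑ w ∈ ({[]} : Finset (List Step)), x ^ w.length :=
          Finset.sum_le_sum_of_subset_of_nonneg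
            (fun w hw => Finset.mem_singleton.2 (Finset.mem_filter.1 hw).2)
            fun _ _ _ => pow_nonneg hx _
      _ = 1 := by simp
  · intro w hw
    obtain ⟨hw, hne⟩ := Finset.mem_filter.1 hw
    obtain ⟨-, -, hH, hle⟩ := mem_biUnion_sawWords_filter.1 hw
    have h1 := one_le_maxLevel_of_ne_nil hH hne
    simp only [Finset.mem_Icc]
    omega

/-! ## The product bound -/

/-- **Hammersley–Welsh product bound in generating-function form** (Madras–Slade (3.1.2)–(3.1.4)):
given the one-step cut of non-empty self-avoiding half-space words at their last maximum (an
injective map to (bridge word of span `A₁`, half-space word of maximal level `≤ A₁ - 1`) with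
lengths adding up), for every real `x ≥ 0` and all `N h`, the `x`-mass of the self-avoiding
half-space words of length `≤ N` and maximal level `≤ h` is at most
`∏_{a=1}^{h} (1 + B_N(a))`, `B_N(a)` the `x`-mass of the self-avoiding bridge words of span `a` and
length `≤ N`. The fibre bound gives `M_N(h) ≤ 1 + ∑_{a=1}^{h} B_N(a) M_N(a-1)` and the renewal
induction `le_prod_of_renewal` concludes. [cite: MadrasSlade1993, §3.1, eq. (3.1.2)–(3.1.4)] -/
theorem hw_product_bound : (∃ cut : List Step → List Step × List Step, Function.Injective cut ∧
    ∀ w : List Step, IsSAW w → Zd.IsHalfSpace w.length (traj w) → w ≠ [] → IsSAW (cut w).1 ∧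
    IsBridgeW (cut w).1 ∧ xEnd (cut w).1 = Zd.maxLevel w.length (traj w) ∧ IsSAW (cut w).2 ∧
    Zd.IsHalfSpace (cut w).2.length (traj (cut w).2) ∧
    Zd.maxLevel (cut w).2.length (traj (cut w).2) + 1 ≤ Zd.maxLevel w.length (traj w) ∧
    (cut w).1.length + (cut w).2.length = w.length) → ∀ x : ℝ, 0 ≤ x → ∀ N h : ℕ,
    (∑ w ∈ (Finset.range (N + 1)).biUnion (fun n => (sawWords n).filter (fun w =>
      Zd.IsHalfSpace w.length (traj w) ∧ Zd.maxLevel w.length (traj w) ≤ (h : ℤ))),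
      x ^ w.length) ≤ ∏ a ∈ Finset.Icc 1 h, (1 + ∑ w ∈ (Finset.range (N + 1)).biUnion (fun n =>
      (sawWords n).filter (fun w => IsBridgeW w ∧ xEnd w = (a : ℤ))), x ^ w.length) := by
  rintro ⟨cut, hinj, hcut⟩ x hx N h
  refine le_prod_of_renewal
    (M := fun k => ∑ w ∈ (Finset.range (N + 1)).biUnion (fun n => (sawWords n).filter (fun w =>
      Zd.IsHalfSpace w.length (traj w) ∧ Zd.maxLevel w.length (traj w) ≤ (k : ℤ))),
      x ^ w.length)
    (B := fun a => ∑ w ∈ (Finset.range (N + 1)).biUnion (fun n =>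
      (sawWords n).filter (fun w => IsBridgeW w ∧ xEnd w = (a : ℤ))), x ^ w.length)
    (fun a => Finset.sum_nonneg fun w _ => pow_nonneg hx _) (fun k => ?_) h
  exact (halfSpaceMass_le_one_add_sum_fibre hx N k).trans (add_le_add le_rfl
    (Finset.sum_le_sum fun a _ => fibre_mass_le hinj hcut hx N k a))

end Summit.CriticalPhenomena.SAWScalingLimit.Theorems.CriticalBubbleBound.Kesten.HW

end
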